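import Literature.AlgebraicGeometry.HodgeTheory.DivisorAlgebraTypeFourEndLevel
import Literature.AlgebraicGeometry.HodgeTheory.DivisorLefschetzGroupEigenspaceSplitting
import HarnessLib

/-!
# Moonen–Zarhin's Lemma (1), second sentence: «for `X` of type 4 with either `d ≥ 2` or `m ≥ 2` this [the centre
# `Z(G_div(X)) = U_{K_B} = U_E`] is a connected torus of rank `e₀`» — ON `ℂ`-POINTS, FROM `End(X)`-LEVEL DATA:
# `Z(G_div(X)(ℂ)) ≅ (ℂ^×)^{e₀}`, `2 e₀ = [E : ℚ]` (Moonen–Zarhin 1998 §1, on the carrier `H¹(X(ℂ); ℂ)`)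

Layer `Literature/AlgebraicGeometry/HodgeTheory`; THEOREMS ONLY — no definition, no named fact, no `sorry` (D-0026, net
debt 0).  Sequel of the seat's `DivisorAlgebraTypeFourEndLevel` (generation 26: for `X` with CM centre `E = ℚ(ψ)` and
`End(X)` non-commutative, `B ⊗ ℂ = End⁰(X) ⊗ ℂ`, `G_div(X)(ℂ) = S(X)(ℂ)` and Lemma (1) «`z ∈ Z(G_div(X)(ℂ)) ⟺ z ∈ ℂ[ψ^*]`»,
`mem_center_divisorLefschetzGroup_iff_coe_mem_adjoin_singleton_of_CMCentre_End_of_ne`) and of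
`DivisorLefschetzGroupEigenspaceSplitting` (generation 14: the elements `p(ζ^*)` with `a a† = 1`, i.e.
`p(τ) p(q(τ)) = 1` at the eigenvalues, underlie elements of `G_div(X)(ℂ)` — `exists_mem_divisorLefschetzGroup_coe_eq_aeval_of_adjoint`,
`…_iff`, `eq_of_coe_eq_aeval_of_forall_eval_eq`).  Together they give the GROUP STRUCTURE of the centre on `ℂ`-points.

## The print

B. J. J. Moonen, Yu. G. Zarhin, *Weil classes on abelian varieties*, J. reine angew. Math. **496** (1998) 83–92 =
arXiv:alg-geom/9612017 [MoonenZarhin1998WeilClasses], §1 (held text `paper:arxiv-alg-geom_9612017`).  Chunk p0002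
L46–L48: «let `E` be the center of `D`, and let `E₀` be the maximal totally real subfield of `E`. We write `e₀ = [E₀:ℚ]`,
`e = [E:ℚ]`, `d² = dim_E(D)`»; L121–L127, Lemma, VERBATIM: «(1) The center of `G_div(X)` is the group `U_{K_B}` given by
`U_{K_B}(R) = {a ∈ (K_B ⊗_ℚ R)^* ∣ a a† = 1}`. For `X` of type 4 with either `d ≥ 2` or `m ≥ 2` this is a connected torus of
rank `e₀`; in all other cases it is finite.»; chunk p0003 L8–L10: «Proof. To prove this, we can first extend scalars to `ℂ`,
and (1) and (2) then readily follow from Table 2.»; L97–L100: «`U_E = Z(G_div) ⊂ G_div(X)` … The torus `U_E` being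
connected …».  J. S. Milne, *Lefschetz classes on abelian varieties*, Duke Math. J. **96** (1999) [Milne1999LefschetzClasses],
§2 pp. 645–651 (the decomposition of `C(A) ⊗ k` and `S(A)` over the embeddings of the centre; type IV).

## What is proved

Setting (as in `DivisorAlgebraTypeFourEndLevel`): `A` a complex abelian variety, `h ∈ B¹(A) ⊗ ℂ` with `Q_h` non-degenerate
on `H¹(A(ℂ); ℂ)`; `ψ ∈ End(A)` central with `R(ψ) = 0`, `R ∈ ℤ[T]` monic irreducible over `ℚ` (so `E = ℚ(ψ)`, `[E:ℚ] =
deg R`); its Rosati image `ψ'` (`Q_h(ψ^* x, y) = Q_h(x, ψ'^* y)`) with `N'ψ' ∈ ℤ[ψ]` and `ψ' ≠ ψ` (CM); every `g ∈ End(A)`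
commuting with `End(A)` has `N g ∈ ℤ[ψ]` («`Z(End⁰(A)) = E`»); and `α ≫ β ≠ β ≫ α` in `End(A)` («`d ≥ 2` or `m ≥ 2`»).
On the carrier, `ψ'^* = q(ψ^*)` for a polynomial `q`, and `τ ↦ q(τ)` is a fixed-point-free involution of the set `Σ` of
eigenvalues of `ψ^*` (= the complex roots of `R`, the embeddings of `E`); a HALF-SYSTEM is a set `H ⊆ Σ` of
representatives (`τ ∈ H ⟺ q(τ) ∉ H`), `#H = e₀ = [E₀ : ℚ] = (deg R)/2`.

* §1 (eigenvalues) `eval₂_eq_zero_of_hasEigenvalue_pullbackOne` / `hasEigenvalue_pullbackOne_of_eval₂_eq_zero` (for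
  `0 < dim A` the eigenvalues of `ψ^*` are exactly the complex roots of `R`), `hasEigenvalue_of_hasEigenvalue_rosati`
  (an eigenvalue of the Rosati image `ψ'^*` is an eigenvalue of `ψ^*`, `Q_h` non-degenerate).
* §2 **`nonempty_center_divisorLefschetzGroup_mulEquiv_pi_units_of_halfSystem`** — for every half-system `H`:
  `Z(G_div(X)(h)(ℂ)) ≃* (H → ℂ^×)`, the isomorphism sending a central `z = p(ψ^*)` to its eigenvalues `(p(σ))_{σ ∈ H}` on
  the blocks `V_σ = ker(ψ^* − σ)`, `σ ∈ H` (the values on the other blocks being forced: `p(q(σ)) = p(σ)⁻¹`, «`a a† = 1`»).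
* §3 **`exists_nonempty_center_divisorLefschetzGroup_mulEquiv_pi_units_of_CMCentre_End_of_ne`** — THE PRINT'S FORM:
  there is `e₀` with `2 e₀ = deg R = [E : ℚ]` and `Z(G_div(X)(h)(ℂ)) ≃* (ℂ^×)^{e₀}` («a torus of rank `e₀`», `ℂ`-points;
  a half-system exists and has `(deg R)/2` elements), and **`infinite_center_divisorLefschetzGroup_of_CMCentre_End_of_ne`**
  (in particular the centre is infinite — contrast «in all other cases it is finite»).

## Scope (honest column)

`ℂ`-points only: «connected» and «torus» as statements about algebraic groups over `ℚ`/`ℝ` are not formalised; what is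
proved is the abstract group structure `(ℂ^×)^{e₀}` of `Z(G_div(X))(ℂ)` and `2e₀ = [E:ℚ]` (so `e₀ = [E₀:ℚ]` for the CM
field `E`, whose maximal totally real subfield is not named here).  «In all other cases it is finite» is not in this
file.

## References

* [MoonenZarhin1998WeilClasses] B. J. J. Moonen, Yu. G. Zarhin, Weil classes on abelian varieties, J. reine angew. Math.
  496 (1998) 83–92; arXiv:alg-geom/9612017: §1 Lemma (1) (chunk p0002 L121–L127), proof (chunk p0003 L8–L10, L97–L100).
* [Milne1999LefschetzClasses] J. S. Milne, Lefschetz classes on abelian varieties, Duke Math. J. 96 (1999) 639–675, §2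
  pp. 645–651.
* [LangeBirkenhake1992] H. Lange, Ch. Birkenhake, Complex Abelian Varieties, §5.1 (Rosati involution = adjoint), §5.5.
* [Deligne1982HodgeCycles] P. Deligne, Hodge cycles on abelian varieties, LNM 900 (1982), I §3 Prop. 3.4.

## Provenance

Lane `lit-hodgefound` (Track 2, Layer A), prover seat `lit-hodgefound-p21` (generation 26), row g26-#5.
-/

noncomputable section

open CategoryTheory Polynomial Module
open Literature.AlgebraicTopology.SingularHomology
open Literature.AlgebraicGeometry.Motives
open Literature.AlgebraicGeometry.VanGeemen1994 (hodgeClassSpan pullbackOne)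
open Literature.AlgebraicGeometry.Milne1999
open Literature.RingTheory.SimpleModule (adj adj_spec' eq_adj_of_forall adj_mul adj_add adj_smul adj_one adj_adj_of_isAlt)

namespace Literature.AlgebraicGeometry.HodgeTheory

/-! ### §0 (private) polynomial calculus of the adjoint; a half-system of a fixed-point-free involution -/

section Prelim

/-- `(Xⁿ)† = (X†)ⁿ`. [folklore] -/
private theorem adj_pow' {V : Type*} [AddCommGroup V] [Module ℂ V] [FiniteDimensional ℂ V]
    (B : LinearMap.BilinForm ℂ V) (hB : B.Nondegenerate) (X : Module.End ℂ V) (n : ℕ) :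
    adj B hB (X ^ n) = adj B hB X ^ n := by
  induction n with
  | zero => rw [pow_zero, pow_zero, adj_one]
  | succ n ih => rw [pow_succ, adj_mul, ih, ← pow_succ']

/-- `p(X)† = p(X†)` for a polynomial `p`. [folklore] -/
private theorem adj_aeval' {V : Type*} [AddCommGroup V] [Module ℂ V] [FiniteDimensional ℂ V]
    (B : LinearMap.BilinForm ℂ V) (hB : B.Nondegenerate) (X : Module.End ℂ V) (p : ℂ[X]) :
    adj B hB (aeval X p) = aeval (adj B hB X) p := by
  induction p using Polynomial.induction_on' with
  | add p q hp hq => rw [map_add, map_add, adj_add, hp, hq]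
  | monomial n c =>
    rw [aeval_monomial, aeval_monomial, Algebra.algebraMap_eq_smul_one, adj_mul, adj_pow', adj_smul, adj_one,
      mul_smul_comm, mul_one, smul_mul_assoc, one_mul]

/-- A fixed-point-free involution `c` of a finite set `s` has a HALF-SYSTEM: a subset `H ⊆ s` meeting each orbit
`{τ, c τ}` in exactly one point, `2 #H = #s`. [folklore] -/
private theorem exists_halfSystem {s : Finset ℂ} {c : ℂ → ℂ} (hcs : ∀ τ ∈ s, c τ ∈ s)
    (hcc : ∀ τ ∈ s, c (c τ) = τ) (hne : ∀ τ ∈ s, c τ ≠ τ) :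
    ∃ H : Finset ℂ, H ⊆ s ∧ (∀ τ ∈ s, τ ∈ H ↔ c τ ∉ H) ∧ 2 * H.card = s.card := by
  classical
  letI : LinearOrder ℂ := WellOrderingRel.isWellOrder.linearOrder
  refine ⟨s.filter (fun τ ↦ τ < c τ), Finset.filter_subset _ _, fun τ hτ ↦ ?_, ?_⟩
  · simp only [Finset.mem_filter, hτ, hcs τ hτ, hcc τ hτ, true_and, not_lt]
    exact ⟨le_of_lt, fun hle ↦ lt_of_le_of_ne hle (hne τ hτ).symm⟩
  · -- `s = H ⊔ H'` with `c : H → H'` a bijection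
    have hsplit := Finset.card_filter_add_card_filter_not (s := s) (fun τ ↦ τ < c τ)
    have hH' : (s.filter (fun τ ↦ ¬τ < c τ)).card = (s.filter (fun τ ↦ τ < c τ)).card := by
      symm
      refine Finset.card_bij (fun τ _ ↦ c τ) (fun τ hτ ↦ ?_) (fun τ₁ hτ₁ τ₂ hτ₂ e ↦ ?_) (fun τ' hτ' ↦ ?_)
      · rw [Finset.mem_filter] at hτ ⊢
        refine ⟨hcs τ hτ.1, ?_⟩
        rw [hcc τ hτ.1, not_lt]
        exact le_of_lt hτ.2
      · rw [Finset.mem_filter] at hτ₁ hτ₂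
        rw [← hcc τ₁ hτ₁.1, ← hcc τ₂ hτ₂.1, e]
      · rw [Finset.mem_filter] at hτ'
        refine ⟨c τ', ?_, hcc τ' hτ'.1⟩
        rw [Finset.mem_filter]
        refine ⟨hcs τ' hτ'.1, ?_⟩
        rw [hcc τ' hτ'.1]
        exact lt_of_le_of_ne (not_lt.1 hτ'.2) (hne τ' hτ'.1)
    omega

/-- `ℂ^×` is infinite. [folklore] -/
private theorem infinite_units_complex : Infinite ℂˣ := by
  refine Infinite.of_injective (fun n : ℕ ↦ Units.mk0 ((n : ℂ) + 1) (by exact_mod_cast Nat.succ_ne_zero n))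
    fun m n e ↦ ?_
  have e' := congrArg (fun u : ℂˣ ↦ (u : ℂ)) e
  simp only [Units.val_mk0, add_left_inj, Nat.cast_inj] at e'
  exact e'

end Prelim

/-! ### §1 The eigenvalues of `ψ^*`: the complex roots of `R`; stable under the Rosati image -/

section Eigenvalues

variable {A : AbelianVariety ℂ} {h : complexBetti A.X 2} {ψ ψ' : A ⟶ A} {R : Polynomial ℤ}

/-- An eigenvalue of `ψ^*` on `H¹(A(ℂ); ℂ)` is a complex root of any `R ∈ ℤ[T]` with `R(ψ) = 0`.
[cite: MoonenZarhin1998WeilClasses, §1 (chunk p0001: «V_ℂ = ⊕_{σ ∈ Σ} V_{ℂ,σ}»)] -/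
theorem eval₂_eq_zero_of_hasEigenvalue_pullbackOne
    (hψR : Polynomial.eval₂ (Int.castRingHom (CategoryTheory.End A)) (ψ : CategoryTheory.End A) R = 0) {τ : ℂ}
    (hτ : Module.End.HasEigenvalue (pullbackOne A ψ) τ) : Polynomial.eval₂ (Int.castRingHom ℂ) τ R = 0 := by
  obtain ⟨x, hx⟩ := hτ.exists_hasEigenvector
  have h0 := aeval_hom_complexBetti_map_one_eq_zero hψR
  have e : (R.map (Int.castRingHom ℂ)).eval τ • x = 0 := by
    rw [← Module.End.aeval_apply_of_hasEigenvector hx]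
    exact LinearMap.congr_fun h0 x
  rw [Polynomial.eval_map] at e
  exact (smul_eq_zero.1 e).resolve_right hx.2

/-- Conversely every complex root of `R` (monic, irreducible over `ℚ`, `R(ψ) = 0`) is an eigenvalue of `ψ^*` when
`0 < dim A` (its eigenspace has dimension `2 dim A / deg R`, the tree's `finrank_eigenspace_mul_natDegree_eq`).
[cite: MoonenZarhin1998WeilClasses, §1 (chunk p0001; «n_σ + n_σ' = 2g/[F:ℚ]»)] -/
theorem hasEigenvalue_pullbackOne_of_eval₂_eq_zero (hA : 0 < A.dim) (hRm : R.Monic)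
    (hRirr : Irreducible (R.map (Int.castRingHom ℚ)))
    (hψR : Polynomial.eval₂ (Int.castRingHom (CategoryTheory.End A)) (ψ : CategoryTheory.End A) R = 0) {ρ : ℂ}
    (hρ : Polynomial.eval₂ (Int.castRingHom ℂ) ρ R = 0) : Module.End.HasEigenvalue (pullbackOne A ψ) ρ := by
  rw [Module.End.hasEigenvalue_iff]
  intro hbot
  have e := finrank_eigenspace_mul_natDegree_eq hRm hRirr hψR hρ
  change Module.finrank ℂ ↥((pullbackOne A ψ).eigenspace ρ) * R.natDegree = 2 * A.dim at e
  rw [hbot, finrank_bot, zero_mul] at e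
  omega

/-- **An eigenvalue of the Rosati image `ψ'^*` is an eigenvalue of `ψ^*`** (`Q_h` non-degenerate): if `ψ'^* w = μ w`,
`w ≠ 0`, and `μ` were not an eigenvalue of `ψ^*`, then `ψ^* − μ` would be onto and `Q_h(v′, w) = Q_h((ψ^* − μ)v, w) =
Q_h(v, (ψ'^* − μ) w) = 0` for all `v′`. [cite: LangeBirkenhake1992, §5.1 (the Rosati involution as the adjoint)] -/
theorem hasEigenvalue_of_hasEigenvalue_rosati
    (hnd : ∀ x : complexBetti A.X 1, (∀ y, polarizationPairingOne A.X h (A.dim - 1) x y = 0) → x = 0)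
    (hadj : ∀ x y : complexBetti A.X 1, polarizationPairingOne A.X h (A.dim - 1) (pullbackOne A ψ x) y =
      polarizationPairingOne A.X h (A.dim - 1) x (pullbackOne A ψ' y))
    {μ : ℂ} (hμ : Module.End.HasEigenvalue (pullbackOne A ψ') μ) : Module.End.HasEigenvalue (pullbackOne A ψ) μ := by
  haveI : Module.Finite ℂ (complexBetti A.X 1) := abelianVarietyCohomologyExteriorH1_holds.finite_one A
  obtain ⟨B, hBalt, hBnd, lam, hlam, hBQ⟩ := exists_bilinForm_isAlt_nondegenerate (A := A) hnd
  by_contra hT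
  rw [Module.End.hasEigenvalue_iff, not_not] at hT
  obtain ⟨w, hw⟩ := hμ.exists_hasEigenvector
  set T := pullbackOne A ψ with hTdef
  set T' := pullbackOne A ψ' with hT'def
  -- `T - μ` is injective, hence surjective
  have hinj : Function.Injective (T - μ • (1 : Module.End ℂ (complexBetti A.X 1))) := by
    rw [injective_iff_map_eq_zero]
    intro v hv
    have hv' : v ∈ T.eigenspace μ := by
      rw [Module.End.mem_eigenspace_iff]
      rw [LinearMap.sub_apply, LinearMap.smul_apply, Module.End.one_apply, sub_eq_zero] at hv
      exact hv
    rw [hT] at hv'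
    exact (Submodule.mem_bot ℂ).1 hv'
  have hsurj : Function.Surjective (T - μ • (1 : Module.End ℂ (complexBetti A.X 1))) :=
    LinearMap.injective_iff_surjective.1 hinj
  -- `B(v', w) = 0` for every `v'`
  have hzero : ∀ v', B v' w = 0 := by
    intro v'
    obtain ⟨v, rfl⟩ := hsurj v'
    have e1 : B (T v) w = μ • B v w := by
      rw [hBQ (T v) w, hadj, hw.apply_eq_smul, map_smul, map_smul, ← hBQ]
    rw [LinearMap.sub_apply, LinearMap.smul_apply, Module.End.one_apply, map_sub, LinearMap.sub_apply, map_smul,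
      LinearMap.smul_apply, e1, sub_self]
  -- contradiction with non-degeneracy
  exact hw.2 (hBnd.1 w fun v' ↦ by rw [← hBalt.neg_eq, hzero, neg_zero])

end Eigenvalues

/-! ### §2 The centre as a torus: `Z(G_div(X)(ℂ)) ≅ (H → ℂ^×)` for a half-system `H` -/

section Torus

variable {A : AbelianVariety ℂ} {h : complexBetti A.X 2} {ψ ψ' α β : A ⟶ A} {R : Polynomial ℤ}

/-- A central `ψ` has `ψ^* ∈ C(A) ⊗ ℂ`. [cite: Milne1999LefschetzClasses, §1 p. 642 (C(A))] -/
private theorem pullbackOne_mem_centralizerAlgebra_of_central'' (hψ : ∀ χ : A ⟶ A, ψ ≫ χ = χ ≫ ψ) :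
    pullbackOne A ψ ∈ centralizerAlgebra A := by
  refine mem_centralizerAlgebra_iff.2 fun χ ↦ ?_
  rw [← pullbackOne_comp_eq_mul, ← pullbackOne_comp_eq_mul, hψ χ]

/-- Pull-back is faithful: a non-commuting pair in `End(A)` forces `0 < dim A`.
[cite: Milne1999LefschetzClasses, §1 Remark 1.2 (p. 643)] -/
private theorem dim_pos_of_comp_ne (hαβ : α ≫ β ≠ β ≫ α) : 0 < A.dim := by
  by_contra h0
  have hd : A.dim = 0 := by omega
  haveI : Module.Finite ℂ (complexBetti A.X 1) := abelianVarietyCohomologyExteriorH1_holds.finite_one A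
  have hV : Module.finrank ℂ (complexBetti A.X 1) = 0 := by
    rw [AbelianVariety.finrank_complexBetti_one, hd, mul_zero]
  haveI : Subsingleton (complexBetti A.X 1) := Module.finrank_zero_iff.1 hV
  have e : pullbackOne A (α ≫ β) = pullbackOne A (β ≫ α) := Subsingleton.elim _ _
  exact hαβ (AbelianVariety.hom_eq_of_complexBetti_map_one_eq (ModuleCat.hom_ext e))

/-- **LEMMA (1), «A TORUS OF RANK `e₀`», `ℂ`-POINTS, FOR A GIVEN HALF-SYSTEM.**  Under the `End(X)`-level type-4 hypotheses
(centre `E = ℚ(ψ)` CM: `ψ` central, `R(ψ) = 0`, Rosati image `ψ'` with `N'ψ' ∈ ℤ[ψ]`, `ψ' ≠ ψ`, `Z(End⁰) = E`; `End(X)` not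
commutative: `α ≫ β ≠ β ≫ α`), with `ψ'^* = q(ψ^*)` on `H¹(A(ℂ); ℂ)` and `H` a HALF-SYSTEM of eigenvalues of `ψ^*` (`τ ∈ H ⟺
q(τ) ∉ H` for every eigenvalue `τ`): THE CENTRE OF `G_div(X)(h)(ℂ)` IS ISOMORPHIC TO `(ℂ^×)^H` — a central element is
`z = p(ψ^*)` with `p(τ) p(q(τ)) = 1` («`a a† = 1`»), and `z ↦ (p(σ))_{σ ∈ H}` is a group isomorphism (injective: `z` is
determined by its eigenvalues, those off `H` being the inverses of those on `H`; surjective: Lagrange interpolation and the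
seat's `exists_mem_divisorLefschetzGroup_coe_eq_aeval_of_adjoint`).
[cite: MoonenZarhin1998WeilClasses, §1 Lemma (1) (chunk p0002 L121–L127: «For X of type 4 with either d ≥ 2 or m ≥ 2 this is a connected torus of rank e₀») and chunk p0003 L97–L100 («U_E = Z(G_div)»)]
[cite: Milne1999LefschetzClasses, §2 pp. 645–651] -/
theorem nonempty_center_divisorLefschetzGroup_mulEquiv_pi_units_of_halfSystem (hh : h ∈ hodgeClassSpan A.dim A.X 1)
    (hnd : ∀ x : complexBetti A.X 1, (∀ y, polarizationPairingOne A.X h (A.dim - 1) x y = 0) → x = 0)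
    (hψ : ∀ χ : A ⟶ A, ψ ≫ χ = χ ≫ ψ) (hRm : R.Monic) (hRirr : Irreducible (R.map (Int.castRingHom ℚ)))
    (hψR : Polynomial.eval₂ (Int.castRingHom (CategoryTheory.End A)) (ψ : CategoryTheory.End A) R = 0)
    (hadj : ∀ x y : complexBetti A.X 1, polarizationPairingOne A.X h (A.dim - 1) (pullbackOne A ψ x) y =
      polarizationPairingOne A.X h (A.dim - 1) x (pullbackOne A ψ' y))
    (hψ'E : ∃ N : ℤ, N ≠ 0 ∧ End.of (N • ψ') ∈ Subring.closure {End.of ψ}) (hne : ψ' ≠ ψ)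
    (hZ : ∀ g : A ⟶ A, (∀ χ : A ⟶ A, g ≫ χ = χ ≫ g) →
      ∃ N : ℤ, N ≠ 0 ∧ End.of (N • g) ∈ Subring.closure {End.of ψ})
    (hαβ : α ≫ β ≠ β ≫ α) {q : ℂ[X]} (hq : aeval (pullbackOne A ψ) q = pullbackOne A ψ') (H : Finset ℂ)
    (hHev : ∀ σ ∈ H, Module.End.HasEigenvalue (pullbackOne A ψ) σ)
    (hH : ∀ τ : ℂ, Module.End.HasEigenvalue (pullbackOne A ψ) τ → (τ ∈ H ↔ q.eval τ ∉ H)) :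
    Nonempty (Subgroup.center (divisorLefschetzGroup A h) ≃* (↥H → ℂˣ)) := by
  classical
  haveI : Module.Finite ℂ (complexBetti A.X 1) := abelianVarietyCohomologyExteriorH1_holds.finite_one A
  set T : Module.End ℂ (complexBetti A.X 1) := pullbackOne A ψ with hTdef
  set G := divisorLefschetzGroup A h with hGdef
  have hTC : T ∈ centralizerAlgebra A := pullbackOne_mem_centralizerAlgebra_of_central'' hψ
  have hadjq : ∀ x y : complexBetti A.X 1, polarizationPairingOne A.X h (A.dim - 1) (T x) y =
      polarizationPairingOne A.X h (A.dim - 1) x (aeval T q y) := fun x y ↦ by rw [hq]; exact hadj x y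
  -- Lemma (1): central iff in `ℂ[ψ^*]`
  have hcen : ∀ {z : G}, z ∈ Subgroup.center G ↔
      ((z : complexBetti A.X 1 ≃ₗ[ℂ] complexBetti A.X 1) : Module.End ℂ (complexBetti A.X 1)) ∈
        Algebra.adjoin ℂ ({T} : Set (Module.End ℂ (complexBetti A.X 1))) :=
    mem_center_divisorLefschetzGroup_iff_coe_mem_adjoin_singleton_of_CMCentre_End_of_ne hh hnd hψ hRm hRirr hψR hadj hψ'E
      hne hZ hαβ
  -- polynomial representatives of the central elements
  have hex : ∀ z : Subgroup.center G, ∃ p : ℂ[X],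
      ((z.1 : complexBetti A.X 1 ≃ₗ[ℂ] complexBetti A.X 1) : Module.End ℂ (complexBetti A.X 1)) = aeval T p := by
    intro z
    have hz := hcen.1 z.2
    rw [Algebra.adjoin_singleton_eq_range_aeval] at hz
    obtain ⟨p, hp⟩ := (AlgHom.mem_range _).1 hz
    exact ⟨p, hp.symm⟩
  choose p hp using hex
  -- «`a a† = 1`»
  have hrel : ∀ (z : Subgroup.center G) (τ : ℂ), Module.End.HasEigenvalue T τ →
      (p z).eval τ * (p z).eval (q.eval τ) = 1 := fun z ↦
    (exists_mem_divisorLefschetzGroup_coe_eq_aeval_iff hRirr hψR hTC hadjq hnd (p z)).1 ⟨z.1.1, z.1.2, hp z⟩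
  have hne0 : ∀ (z : Subgroup.center G) (σ : ↥H), (p z).eval (σ : ℂ) ≠ 0 := fun z σ ↦
    left_ne_zero_of_mul_eq_one (hrel z σ (hHev σ σ.2))
  -- a central element acts on `V_τ` as the scalar `p(τ)`
  have hact : ∀ (z : Subgroup.center G) {τ : ℂ} {x : complexBetti A.X 1}, Module.End.HasEigenvector T τ x →
      (z.1 : complexBetti A.X 1 ≃ₗ[ℂ] complexBetti A.X 1) x = (p z).eval τ • x := by
    intro z τ x hx
    have e := LinearMap.congr_fun (hp z) x
    rw [LinearEquiv.coe_coe] at e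
    rw [e, Module.End.aeval_apply_of_hasEigenvector hx]
  -- the map `z ↦ (p(σ))_{σ ∈ H}`
  let Φ₀ : Subgroup.center G → (↥H → ℂˣ) := fun z σ ↦ Units.mk0 _ (hne0 z σ)
  have hΦ₀ : ∀ z σ, ((Φ₀ z σ : ℂˣ) : ℂ) = (p z).eval (σ : ℂ) := fun z σ ↦ rfl
  have hmul : ∀ z w, Φ₀ (z * w) = Φ₀ z * Φ₀ w := by
    intro z w
    funext σ
    ext
    rw [Pi.mul_apply, Units.val_mul, hΦ₀, hΦ₀, hΦ₀]
    obtain ⟨x, hx⟩ := (hHev σ σ.2).exists_hasEigenvector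
    have e1 := hact (z * w) hx
    have e2 : ((z * w).1 : complexBetti A.X 1 ≃ₗ[ℂ] complexBetti A.X 1) x =
        ((p z).eval (σ : ℂ) * (p w).eval (σ : ℂ)) • x := by
      change ((z.1 : complexBetti A.X 1 ≃ₗ[ℂ] complexBetti A.X 1) * (w.1 : complexBetti A.X 1 ≃ₗ[ℂ] complexBetti A.X 1)) x = _
      rw [LinearEquiv.mul_apply, hact w hx, map_smul, hact z hx, smul_smul, mul_comm]
    rw [e1] at e2
    exact smul_left_injective ℂ hx.2 e2
  let Φ : Subgroup.center G →* (↥H → ℂˣ) := MonoidHom.mk' Φ₀ hmul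
  have hΦ : ∀ z σ, ((Φ z σ : ℂˣ) : ℂ) = (p z).eval (σ : ℂ) := fun z σ ↦ rfl
  -- `q` is an involution of the eigenvalues, which it permutes
  obtain ⟨B, hBalt, hBnd, lam, hlam, hBQ⟩ := exists_bilinForm_isAlt_nondegenerate (A := A) hnd
  have hTadj : adj B hBnd T = pullbackOne A ψ' := by
    symm
    refine eq_adj_of_forall B hBnd fun v w ↦ ?_
    rw [← hBalt.neg_eq, ← hBalt.neg_eq (T w), hBQ, hBQ, hadj]
  have hTqq : aeval T (q.comp q) = T := by
    rw [Polynomial.aeval_comp, hq, ← hTadj, ← adj_aeval' B hBnd, hq, ← hTadj, adj_adj_of_isAlt B hBnd hBalt]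
  have hqq : ∀ τ : ℂ, Module.End.HasEigenvalue T τ → q.eval (q.eval τ) = τ := by
    intro τ hτ
    obtain ⟨x, hx⟩ := hτ.exists_hasEigenvector
    have e := Module.End.aeval_apply_of_hasEigenvector hx (p := q.comp q)
    rw [hTqq, hx.apply_eq_smul, Polynomial.eval_comp] at e
    exact (smul_left_injective ℂ hx.2 e).symm
  have hqev : ∀ τ : ℂ, Module.End.HasEigenvalue T τ → Module.End.HasEigenvalue T (q.eval τ) := by
    intro τ hτ
    obtain ⟨x, hx⟩ := hτ.exists_hasEigenvector
    refine hasEigenvalue_of_hasEigenvalue_rosati hnd hadj (Module.End.hasEigenvalue_of_hasEigenvector (x := x) ⟨?_, hx.2⟩)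
    rw [Module.End.mem_eigenspace_iff, ← hq, Module.End.aeval_apply_of_hasEigenvector hx]
  -- off `H` the value is the inverse of the value at the partner
  have hoff : ∀ (z : Subgroup.center G) (τ : ℂ), Module.End.HasEigenvalue T τ → τ ∉ H →
      q.eval τ ∈ H ∧ (p z).eval τ = ((p z).eval (q.eval τ))⁻¹ := by
    intro z τ hτ hτH
    have hqH : q.eval τ ∈ H := by
      by_contra hq'
      exact hτH ((hH τ hτ).2 hq')
    refine ⟨hqH, ?_⟩
    exact eq_inv_of_mul_eq_one_left (hrel z τ hτ)
  -- injective
  have hinj : Function.Injective Φ := by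
    intro z w hzw
    have hval : ∀ σ : ↥H, (p z).eval (σ : ℂ) = (p w).eval (σ : ℂ) := fun σ ↦ by
      rw [← hΦ z σ, ← hΦ w σ, hzw]
    have hall : ∀ τ : ℂ, Module.End.HasEigenvalue T τ → (p z).eval τ = (p w).eval τ := by
      intro τ hτ
      by_cases hτH : τ ∈ H
      · exact hval ⟨τ, hτH⟩
      · obtain ⟨hqH, ez⟩ := hoff z τ hτ hτH
        obtain ⟨-, ew⟩ := hoff w τ hτ hτH
        rw [ez, ew, hval ⟨q.eval τ, hqH⟩]
    have heq : (z.1 : complexBetti A.X 1 ≃ₗ[ℂ] complexBetti A.X 1) = w.1 :=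
      eq_of_coe_eq_aeval_of_forall_eval_eq hRirr hψR (hp z) (hp w) hall
    exact Subtype.ext (Subtype.ext heq)
  -- surjective
  have hsurj : Function.Surjective Φ := by
    intro c
    let c' : ℂ → ℂ := fun σ ↦ if hσ : σ ∈ H then ((c ⟨σ, hσ⟩ : ℂˣ) : ℂ) else 1
    have hc'H : ∀ σ : ↥H, c' σ = ((c σ : ℂˣ) : ℂ) := fun σ ↦ by simp only [c', dif_pos σ.2]
    have hc'ne : ∀ σ, c' σ ≠ 0 := fun σ ↦ by
      by_cases hσ : σ ∈ H
      · rw [hc'H ⟨σ, hσ⟩]; exact (c ⟨σ, hσ⟩).ne_zero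
      · simp only [c', dif_neg hσ]; exact one_ne_zero
    let f : ℂ → ℂ := fun τ ↦ if τ ∈ H then c' τ else (c' (q.eval τ))⁻¹
    -- interpolate `f` on the roots of `R`
    set s : Finset ℂ := (R.map (Int.castRingHom ℂ)).roots.toFinset with hsdef
    let P : ℂ[X] := Lagrange.interpolate s id f
    have hPev : ∀ τ : ℂ, Module.End.HasEigenvalue T τ → P.eval τ = f τ := by
      intro τ hτ
      have hτs : τ ∈ s := (mem_roots_toFinset_map_iff hRm.ne_zero τ).2 (eval₂_eq_zero_of_hasEigenvalue_pullbackOne hψR hτ)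
      have e := Lagrange.eval_interpolate_at_node (v := id) f (Set.injOn_id _) hτs
      exact e
    have hP : ∀ τ : ℂ, Module.End.HasEigenvalue T τ → P.eval τ * P.eval (q.eval τ) = 1 := by
      intro τ hτ
      rw [hPev τ hτ, hPev _ (hqev τ hτ)]
      by_cases hτH : τ ∈ H
      · have hq' : q.eval τ ∉ H := (hH τ hτ).1 hτH
        simp only [f, if_pos hτH, if_neg hq', hqq τ hτ]
        exact mul_inv_cancel₀ (hc'ne τ)
      · have hq' : q.eval τ ∈ H := by
          by_contra h'
          exact hτH ((hH τ hτ).2 h')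
        simp only [f, if_neg hτH, if_pos hq']
        exact inv_mul_cancel₀ (hc'ne _)
    obtain ⟨u, hu, hup⟩ := exists_mem_divisorLefschetzGroup_coe_eq_aeval_of_adjoint hRirr hψR hTC hadjq P hP
    have hz : (⟨u, hu⟩ : G) ∈ Subgroup.center G := hcen.2 (by
      change (u : Module.End ℂ (complexBetti A.X 1)) ∈ _
      rw [hup]
      exact Polynomial.aeval_mem_adjoin_singleton ℂ _)
    refine ⟨⟨⟨u, hu⟩, hz⟩, ?_⟩
    funext σ
    ext
    rw [hΦ, ← hc'H σ]
    obtain ⟨x, hx⟩ := (hHev σ σ.2).exists_hasEigenvector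
    have e1 := hact ⟨⟨u, hu⟩, hz⟩ hx
    have e2 : u x = P.eval (σ : ℂ) • x := by
      have e := LinearMap.congr_fun hup x
      rw [LinearEquiv.coe_coe] at e
      rw [e, Module.End.aeval_apply_of_hasEigenvector hx]
    have e3 : (p ⟨⟨u, hu⟩, hz⟩).eval (σ : ℂ) = P.eval (σ : ℂ) := smul_left_injective ℂ hx.2 (e1.symm.trans e2)
    rw [e3, hPev σ (hHev σ σ.2)]
    simp only [f, if_pos σ.2]
  exact ⟨MulEquiv.ofBijective Φ ⟨hinj, hsurj⟩⟩

/-- **MOONEN–ZARHIN LEMMA (1): «FOR `X` OF TYPE 4 WITH EITHER `d ≥ 2` OR `m ≥ 2` THIS [`Z(G_div(X)) = U_E`] IS A CONNECTED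
TORUS OF RANK `e₀`» — `ℂ`-POINTS, FROM `End(X)`.**  Under the `End(X)`-level type-4 hypotheses (centre `E = ℚ(ψ)` CM, `R`
the minimal polynomial of `ψ`, `End(X)` not commutative) there is `e₀` with `2 e₀ = deg R = [E : ℚ]` (so `e₀ = [E₀ : ℚ]`)
and a group isomorphism `Z(G_div(X)(h)(ℂ)) ≅ (ℂ^×)^{e₀}`.  (A half-system `H` of the `deg R` eigenvalues under the
fixed-point-free involution `τ ↦ q(τ)`, `ψ'^* = q(ψ^*)`, has `(deg R)/2` elements; then
`nonempty_center_divisorLefschetzGroup_mulEquiv_pi_units_of_halfSystem`.)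
[cite: MoonenZarhin1998WeilClasses, §1 Lemma (1) (chunk p0002 L121–L127) and chunk p0003 L97–L100]
[cite: Milne1999LefschetzClasses, §2 pp. 645–651] -/
theorem exists_nonempty_center_divisorLefschetzGroup_mulEquiv_pi_units_of_CMCentre_End_of_ne
    (hh : h ∈ hodgeClassSpan A.dim A.X 1)
    (hnd : ∀ x : complexBetti A.X 1, (∀ y, polarizationPairingOne A.X h (A.dim - 1) x y = 0) → x = 0)
    (hψ : ∀ χ : A ⟶ A, ψ ≫ χ = χ ≫ ψ) (hRm : R.Monic) (hRirr : Irreducible (R.map (Int.castRingHom ℚ)))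
    (hψR : Polynomial.eval₂ (Int.castRingHom (CategoryTheory.End A)) (ψ : CategoryTheory.End A) R = 0)
    (hadj : ∀ x y : complexBetti A.X 1, polarizationPairingOne A.X h (A.dim - 1) (pullbackOne A ψ x) y =
      polarizationPairingOne A.X h (A.dim - 1) x (pullbackOne A ψ' y))
    (hψ'E : ∃ N : ℤ, N ≠ 0 ∧ End.of (N • ψ') ∈ Subring.closure {End.of ψ}) (hne : ψ' ≠ ψ)
    (hZ : ∀ g : A ⟶ A, (∀ χ : A ⟶ A, g ≫ χ = χ ≫ g) →
      ∃ N : ℤ, N ≠ 0 ∧ End.of (N • g) ∈ Subring.closure {End.of ψ})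
    (hαβ : α ≫ β ≠ β ≫ α) :
    ∃ e₀ : ℕ, 2 * e₀ = R.natDegree ∧
      Nonempty (Subgroup.center (divisorLefschetzGroup A h) ≃* (Fin e₀ → ℂˣ)) := by
  classical
  haveI : Module.Finite ℂ (complexBetti A.X 1) := abelianVarietyCohomologyExteriorH1_holds.finite_one A
  have hA : 0 < A.dim := dim_pos_of_comp_ne hαβ
  set T : Module.End ℂ (complexBetti A.X 1) := pullbackOne A ψ with hTdef
  -- `ψ'^* = q(ψ^*)`
  obtain ⟨q, hq⟩ : ∃ q : ℂ[X], aeval T q = pullbackOne A ψ' := by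
    have hmem := pullbackOne_mem_adjoin_singleton_of_exists_zsmul_mem_closure_singleton (A := A) hψ'E
    rw [Algebra.adjoin_singleton_eq_range_aeval] at hmem
    exact (AlgHom.mem_range _).1 hmem
  -- eigenvalues = roots of `R`
  set s : Finset ℂ := (R.map (Int.castRingHom ℂ)).roots.toFinset with hsdef
  have hsev : ∀ τ : ℂ, τ ∈ s ↔ Module.End.HasEigenvalue T τ := fun τ ↦ by
    rw [hsdef, mem_roots_toFinset_map_iff hRm.ne_zero]
    exact ⟨hasEigenvalue_pullbackOne_of_eval₂_eq_zero hA hRm hRirr hψR, eval₂_eq_zero_of_hasEigenvalue_pullbackOne hψR⟩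
  have hscard : s.card = R.natDegree := by
    have hsep : (R.map (Int.castRingHom ℂ)).Separable := by
      rw [map_castRingHom_complex_eq]; exact hRirr.separable.map
    rw [hsdef, Multiset.toFinset_card_of_nodup (Polynomial.nodup_roots hsep),
      ← Polynomial.Splits.natDegree_eq_card_roots (IsAlgClosed.splits _),
      Polynomial.natDegree_map_eq_of_injective (Int.castRingHom ℂ).injective_int]
  -- `q` is a fixed-point-free involution of `s`
  have hqev : ∀ τ : ℂ, Module.End.HasEigenvalue T τ → Module.End.HasEigenvalue T (q.eval τ) := by
    intro τ hτ
    obtain ⟨x, hx⟩ := hτ.exists_hasEigenvector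
    refine hasEigenvalue_of_hasEigenvalue_rosati hnd hadj (Module.End.hasEigenvalue_of_hasEigenvector (x := x) ⟨?_, hx.2⟩)
    rw [Module.End.mem_eigenspace_iff, ← hq, Module.End.aeval_apply_of_hasEigenvector hx]
  obtain ⟨B, hBalt, hBnd, lam, hlam, hBQ⟩ := exists_bilinForm_isAlt_nondegenerate (A := A) hnd
  have hTadj : adj B hBnd T = pullbackOne A ψ' := by
    symm
    refine eq_adj_of_forall B hBnd fun v w ↦ ?_
    rw [← hBalt.neg_eq, ← hBalt.neg_eq (T w), hBQ, hBQ, hadj]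
  have hTqq : aeval T (q.comp q) = T := by
    rw [Polynomial.aeval_comp, hq, ← hTadj, ← adj_aeval' B hBnd, hq, ← hTadj, adj_adj_of_isAlt B hBnd hBalt]
  have hqq : ∀ τ : ℂ, Module.End.HasEigenvalue T τ → q.eval (q.eval τ) = τ := by
    intro τ hτ
    obtain ⟨x, hx⟩ := hτ.exists_hasEigenvector
    have e := Module.End.aeval_apply_of_hasEigenvector hx (p := q.comp q)
    rw [hTqq, hx.apply_eq_smul, Polynomial.eval_comp] at e
    exact (smul_left_injective ℂ hx.2 e).symm
  have hCM := eigenspace_inf_eigenspace_eq_bot_of_ne_of_exists_zsmul_mem_closure_singleton hRm hRirr hψR hψ'E hne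
  have hqne : ∀ τ : ℂ, Module.End.HasEigenvalue T τ → q.eval τ ≠ τ := by
    intro τ hτ e
    obtain ⟨x, hx⟩ := hτ.exists_hasEigenvector
    have hx' : x ∈ (pullbackOne A ψ').eigenspace τ := by
      rw [Module.End.mem_eigenspace_iff, ← hq, Module.End.aeval_apply_of_hasEigenvector hx, e]
    have hmem : x ∈ T.eigenspace τ ⊓ (pullbackOne A ψ').eigenspace τ := ⟨hx.1, hx'⟩
    rw [hCM τ] at hmem
    exact hx.2 ((Submodule.mem_bot ℂ).1 hmem)
  -- a half-system
  obtain ⟨H, hHs, hH, hHcard⟩ := exists_halfSystem (s := s) (c := fun τ ↦ q.eval τ)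
    (fun τ hτ ↦ (hsev _).2 (hqev τ ((hsev τ).1 hτ))) (fun τ hτ ↦ hqq τ ((hsev τ).1 hτ))
    (fun τ hτ ↦ hqne τ ((hsev τ).1 hτ))
  obtain ⟨Ψ⟩ := nonempty_center_divisorLefschetzGroup_mulEquiv_pi_units_of_halfSystem hh hnd hψ hRm hRirr hψR hadj hψ'E
    hne hZ hαβ hq H (fun σ hσ ↦ (hsev σ).1 (hHs hσ)) (fun τ hτ ↦ hH τ ((hsev τ).2 hτ))
  refine ⟨H.card, by rw [hHcard, hscard], ⟨Ψ.trans ?_⟩⟩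
  exact { Equiv.piCongrLeft' (fun _ : ↥H ↦ ℂˣ) (Finset.equivFin H) with map_mul' := fun _ _ ↦ rfl }

/-- **… IN PARTICULAR THE CENTRE OF `G_div(X)(ℂ)` IS INFINITE** for `X` of type 4 with `d ≥ 2` or `m ≥ 2` (read at
`End(X)`-level as above) — contrast «in all other cases it is finite».
[cite: MoonenZarhin1998WeilClasses, §1 Lemma (1) (chunk p0002 L121–L127)] -/
theorem infinite_center_divisorLefschetzGroup_of_CMCentre_End_of_ne (hh : h ∈ hodgeClassSpan A.dim A.X 1)
    (hnd : ∀ x : complexBetti A.X 1, (∀ y, polarizationPairingOne A.X h (A.dim - 1) x y = 0) → x = 0)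
    (hψ : ∀ χ : A ⟶ A, ψ ≫ χ = χ ≫ ψ) (hRm : R.Monic) (hRirr : Irreducible (R.map (Int.castRingHom ℚ)))
    (hψR : Polynomial.eval₂ (Int.castRingHom (CategoryTheory.End A)) (ψ : CategoryTheory.End A) R = 0)
    (hadj : ∀ x y : complexBetti A.X 1, polarizationPairingOne A.X h (A.dim - 1) (pullbackOne A ψ x) y =
      polarizationPairingOne A.X h (A.dim - 1) x (pullbackOne A ψ' y))
    (hψ'E : ∃ N : ℤ, N ≠ 0 ∧ End.of (N • ψ') ∈ Subring.closure {End.of ψ}) (hne : ψ' ≠ ψ)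
    (hZ : ∀ g : A ⟶ A, (∀ χ : A ⟶ A, g ≫ χ = χ ≫ g) →
      ∃ N : ℤ, N ≠ 0 ∧ End.of (N • g) ∈ Subring.closure {End.of ψ})
    (hαβ : α ≫ β ≠ β ≫ α) : Infinite (Subgroup.center (divisorLefschetzGroup A h)) := by
  obtain ⟨e₀, he₀, ⟨Ψ⟩⟩ := exists_nonempty_center_divisorLefschetzGroup_mulEquiv_pi_units_of_CMCentre_End_of_ne hh hnd hψ
    hRm hRirr hψR hadj hψ'E hne hZ hαβ
  -- `e₀ ≥ 1` since `deg R ≥ 1`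
  have hdeg : 0 < R.natDegree := by
    rw [← Polynomial.natDegree_map_eq_of_injective (RingHom.injective_int (Int.castRingHom ℚ)) R]
    exact Polynomial.natDegree_pos_iff_degree_pos.2 (Polynomial.degree_pos_of_irreducible hRirr)
  have he : 0 < e₀ := by omega
  haveI : Infinite ℂˣ := infinite_units_complex
  haveI : Infinite (Fin e₀ → ℂˣ) := Pi.infinite_of_exists_right (⟨0, he⟩ : Fin e₀)
  exact Infinite.of_injective Ψ.symm Ψ.symm.injective

end Torus

end Literature.AlgebraicGeometry.HodgeTheory

end
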